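import Literature.ModelTheory.ExponentialFields.Wilkie1996Induction
import HarnessLib

/-!
# Wilkie 1996, §§9–11: Lemma 9.3 from the valuation-rank bound (den Besten, §7.2)

Topic `Literature/ModelTheory/ExponentialFields`.  After `Wilkie1996Induction.lean`, the last
unproved printed leaf under Wilkie's theorem in this tree,
`Literature.ModelTheory.ExponentialFields.Wilkie1996_expPolynomialPoints_bounded` (A. J. Wilkie,
J. Amer. Math. Soc. 9 (1996), §9, p. 1083), rests on **9.3** alone (p. 1084; M. den Besten, MSc
thesis, Utrecht 2016, condition (36) and Lemma 7.2.4): for models `k ⊆ K` of `T_exp` and a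
non-singular zero `ᾱ ∈ Kⁿ` of a square system from `Mˢₙ`, if `l ∈ s` and `|α_l| > k` then
`0 < c + Σ_{i ∈ s} nᵢ αᵢ < 1` for some integers `nᵢ`, not all zero, and some `c ∈ k`.

Den Besten proves (36) in §7.2 (pp. 77–82) from the model theory of
`T_e = Th(ℝ; e)`, `e(x) = exp((1 + x²)⁻¹)`, in three steps: (a) the `T_e`-definable closure
`k* = Dcl_{k'}(ᾱ, exp ᾱ_s)` of `k` in `K` has `T_e`-dimension `≤ m = |s|` over `k' ≼ k*`
(the Claim in Lemma 7.2.4: model completeness of `T_e` = First Main Theorem, Corollary 6.2.4,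
and Khovanskiĭ finiteness, Proposition 6.2.7 (iii)); (b) hence, by the **valuation inequality**
for the smooth o-minimal theory `T_e` (Theorems 7.1.23 and 7.2.1), the value group of `k*` has
`ℚ`-rank `≤ m` over that of `k`; (c) Lemmas 7.2.2–7.2.3 and the last paragraph of §7.2: from (b),
by an argument inside the ordered exponential field `K` alone, the `αᵢ` (`i ∈ s`) are
`ℚ`-linearly dependent over `k + Fin(K)`, which gives (36).

This file PROVES step (c) — everything in §7.2 that happens inside `K` — with the output of
(a)+(b) as an explicit hypothesis (`hVR`/`hrank`, "valuation rank of an intermediate field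
`S ∋ αᵢ, exp αᵢ` over `k` is at most `|s|`": any `|s| + 1` nonzero elements of `S` have a
nontrivial integer power product which is, up to a factor from `k`, a unit of the valuation ring
`Fin(K)`), and composes it with the induction of §9:

* `RealExpModel.IsVUnit` (valuation zero), `RealExpModel.NearK` (`k + Fin(S)`, den Besten's `U`),
  `RealExpModel.InfK` (`x > k`), `RealExpModel.InW` (the `ℤ`-span `W` of `U` and the `aᵢ`);
* `RealExpModel.chain_length_le`, `RealExpModel.exists_inW_infK_minimal`: `W` has at most `m`
  archimedean classes of elements infinite over `k`, so one of them, `v`, has minimal class —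
  this REPLACES den Besten's Lemma 7.2.2 (bases of ordered `ℚ`-vector spaces adapted to the
  convex filtration) and lets the whole argument run over `ℤ` (no real-closedness of `S` needed);
* `RealExpModel.not_independent_of_valRank` (Lemma 7.2.3, contradiction form: apply the rank
  bound to `(v, exp a₁, …, exp a_m)`; the Claim in the proof of Lemma 7.2.3 excludes relations among the `exp aᵢ`
  alone; otherwise `v^p ≍ exp(w)` with `w ∈ W` infinite over `k`, `v ≤ M w` by minimality, and
  `exp(w) ≤ N M^p w^p` contradicts `RealExpModel.natCast_mul_pow_lt_exp`);
* `RealExpModel.exists_intCombination_mem_Ioo_of_valRank` (9.3 for one configuration, with the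
  integer-part step `RealExpModel.exists_int_floor_of_abs_le` for "`0 < q - b < 1`");
* `RealExpModel.lemma93_of_valRank` — exactly the hypothesis `h93` of
  `RealExpModel.exists_abs_lt_of_isMsZero_of_lemma93`, from `hVR`;
* `Wilkie1996_expPolynomialPoints_bounded_of_valRank`, `Wilkie1996_expPolynomial_transfer_of_valRank`,
  `wilkie_isModelComplete_of_valRank`, `wilkie_isOMinimal_of_valRank`: the leaf, Wilkie's core
  transfer statement (`Wilkie1996_expPolynomial_transfer`, Wilkie 1999, p. 414), Wilkie's theorem
  and the o-minimality of `ℝ_exp` from `hVR`.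

Also proved here, by transfer from `ℝ`: `RealExpModel.add_one_le_exp` (`a + 1 ≤ exp a` in every
model of `T_exp`) and its consequences `RealExpModel.natCast_mul_pow_lt_exp` ("by simply reasoning
in `ℝ`, there exists `r ∈ ℕ` such that `exp(qx) ≥ Nx` for all `x > r`", proof of Lemma 7.2.3),
`RealExpModel.lt_of_exp_le`, `RealExpModel.neg_lt_of_one_le_mul_exp` ("since `1 + x ≤ exp(x)` …
this implies `d + Σ qᵢvᵢ ∈ Fin(K)`", proof of the Claim in Lemma 7.2.3).

Nothing here is a new named fact.  What is NOT here (the hypothesis `hVR`): steps (a) and (b) —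
the First Main Theorem (model completeness of `T_e`, den Besten ch. 2–5), the o-minimality and
polynomial bounds of `T_e` (via `ℝ_an`, Corollaries 4.1.7–4.1.8), the valuation inequality
(Theorem 7.1.23; Wilkie 1996, §10) and the dimension count of Lemma 7.2.4.

## References

* A. J. Wilkie, *Model completeness results for expansions of the ordered field of real numbers by
  restricted Pfaffian functions and the exponential function*, J. Amer. Math. Soc. 9 (1996),
  1051–1094: §9 (9.3, p. 1084), §§10–11. [WilkieJAMS1996]
* M. den Besten, *Wilkie's Theorem and the Uniform Real Schanuel Conjecture*, MSc thesis, Utrecht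
  (2016): §6.2 (proof of Theorem 6.1.2 assuming (36), pp. 61–66), §7.2 (Lemmas 7.2.2, 7.2.3,
  7.2.4 and the derivation of (36), pp. 77–82). [DenBesten2016]
* A. J. Wilkie, *Model theory of analytic and smooth functions*, in: Models and Computability,
  LMS Lecture Note Ser. 259 (1999), pp. 414–415. [Wilkie1999Survey]
-/

noncomputable section

open FirstOrder FirstOrder.Language FirstOrder.Language.Structure

namespace Literature.ModelTheory.ExponentialFields

namespace RealExpModel

variable {k K : Language.Theory.ModelType.{0, 0, 0} realExpTheory}

/-! ### More consequences of transfer: the growth axiom -/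

/-- `a + 1 ≤ exp a` in every model of `T_exp` (transfer of `Real.add_one_le_exp`). [folklore] -/
theorem add_one_le_exp (a : K) : a + 1 ≤ exp a := by
  have h := realize_sentence_of_real K
    (σ := ∀' (Language.Term.le (&0 + 1) (Language.orderedExpRing.termExp &0)))
    (by
      simp only [Sentence.Realize, Formula.Realize, BoundedFormula.realize_all, Term.realize_le]
      intro x
      simpa [Fin.snoc] using Real.add_one_le_exp x)
  simp only [Sentence.Realize, Formula.Realize, BoundedFormula.realize_all, Term.realize_le] at h
  simpa [Fin.snoc] using h a

/-- `exp (z a) = (exp a) ^ z` for an integer `z`. [folklore] -/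
theorem exp_intCast_mul (z : ℤ) (a : K) : exp ((z : K) * a) = exp a ^ z := by
  cases z with
  | ofNat m => simp [exp_natCast_mul]
  | negSucc m =>
    rw [Int.cast_negSucc, neg_mul, exp_neg', zpow_negSucc, ← exp_natCast_mul]

/-- `exp (Σ zᵢ aᵢ) = ∏ (exp aᵢ) ^ zᵢ` for integers `zᵢ`. [folklore] -/
theorem exp_sum_intCast_mul_eq_prod_zpow {m : ℕ} (ν : Fin m → ℤ) (a : Fin m → K) :
    exp (∑ i, (ν i : K) * a i) = ∏ i, exp (a i) ^ ν i := by
  rw [exp_sum]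
  exact Finset.prod_congr rfl fun i _ => exp_intCast_mul (ν i) (a i)

/-- If `exp y ≤ N` then `y < N`. [folklore] -/
theorem lt_of_exp_le {y : K} {N : ℕ} (h : exp y ≤ N) : y < N := by
  have h1 := add_one_le_exp y
  linarith

/-- If `1 ≤ N * exp y` then `-N < y` (apply the previous bound to `-y`). [folklore] -/
theorem neg_lt_of_one_le_mul_exp {y : K} {N : ℕ} (h : 1 ≤ (N : K) * exp y) : -(N : K) < y := by
  have hN : exp (-y) ≤ N := by
    rw [exp_neg']
    have hpos := exp_pos y
    rw [inv_le_iff_one_le_mul₀ hpos]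
    simpa [mul_comm] using h
  have := lt_of_exp_le hN
  linarith

/-- **Growth of the exponential beyond every polynomial, at infinite arguments**: if `w` exceeds
every natural number then `C w ^ p < exp w` for all naturals `C`, `p` (from
`(1 + w/(p+1))^{p+1} ≤ exp w`). [folklore] -/
theorem natCast_mul_pow_lt_exp {w : K} (hw : ∀ n : ℕ, (n : K) < w) (C p : ℕ) :
    (C : K) * w ^ p < exp w := by
  have hw0 : 0 < w := by simpa using hw 0
  set q : ℕ := p + 1 with hq
  have hqpos : 0 < q := Nat.succ_pos p
  have hqK : (0 : K) < q := by exact_mod_cast hqpos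
  have hdiv : 0 ≤ w / (q : K) := by positivity
  have h1 : (1 + w / (q : K)) ^ q ≤ exp w := by
    have hexp : exp w = exp (w / (q : K)) ^ q := by
      rw [← exp_natCast_mul, mul_div_cancel₀ _ hqK.ne']
    rw [hexp]
    exact pow_le_pow_left₀ (by positivity)
      (by simpa [add_comm] using add_one_le_exp (w / (q : K))) q
  have h2 : (w / (q : K)) ^ q ≤ (1 + w / (q : K)) ^ q :=
    pow_le_pow_left₀ hdiv (by linarith) q
  -- `(w/q)^q = w^p * (w / q^q)` and `w / q^q > C`
  have hbig : (C : K) * (q : K) ^ q < w := by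
    have := hw (C * q ^ q)
    push_cast at this
    exact this
  have h3 : (C : K) * w ^ p < (w / (q : K)) ^ q := by
    rw [div_pow, hq, pow_succ, lt_div_iff₀ (by positivity)]
    have hwp : 0 < w ^ p := pow_pos hw0 p
    nlinarith
  exact lt_of_lt_of_le h3 (h2.trans h1)

/-- **Integer parts of finite elements**: if `|t| ≤ N` then `z ≤ t < z + 1` for some integer `z`
(a model of `T_exp` need not be archimedean, but its finite part has integer parts). [folklore] -/
theorem exists_int_floor_of_abs_le {t : K} {N : ℕ} (h : |t| ≤ N) :
    ∃ z : ℤ, (z : K) ≤ t ∧ t < z + 1 := by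
  classical
  obtain ⟨hl, hu⟩ := abs_le.1 h
  -- the set of `j : ℕ` with `t < -N + j` is nonempty (`j = 2N + 1`); take the least such `j`
  have hex : ∃ j : ℕ, t < -(N : K) + j := ⟨2 * N + 1, by push_cast; linarith⟩
  let j₀ := Nat.find hex
  have hj₀ : t < -(N : K) + j₀ := Nat.find_spec hex
  have hj₀pos : 0 < j₀ := by
    by_contra h0
    have : j₀ = 0 := by omega
    rw [this] at hj₀
    simp at hj₀
    linarith
  have hprev : ¬ t < -(N : K) + (j₀ - 1 : ℕ) := Nat.find_min hex (by omega)
  refine ⟨-(N : ℤ) + (j₀ - 1 : ℕ), ?_, ?_⟩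
  · push_cast
    linarith [not_lt.1 hprev]
  · have h5 : (j₀ - 1 + 1 : ℕ) = j₀ := Nat.sub_add_cancel hj₀pos
    have : ((j₀ - 1 : ℕ) : K) + 1 = j₀ := by exact_mod_cast congrArg (fun n : ℕ => (n : K)) h5
    push_cast
    linarith


/-! ### Units of the valuation ring of a model -/

/-- `y` is a **unit of the valuation ring** `Fin(K)` of the natural (archimedean) valuation of
the model `K`: `1/N ≤ |y| ≤ N` for some natural number `N`, i.e. `y ∈ Fin(K) ∖ μ(K)`, valuation
zero (den Besten §7.1; Wilkie 1996, §10). [cite: DenBesten2016, §7.1] -/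
def IsVUnit (y : K) : Prop := ∃ N : ℕ, 1 ≤ (N : K) * |y| ∧ |y| ≤ N

namespace IsVUnit

/-- A valuation unit is nonzero. [folklore] -/
theorem ne_zero {y : K} (h : IsVUnit y) : y ≠ 0 := by
  rintro rfl
  obtain ⟨N, h1, -⟩ := h
  norm_num at h1

/-- A valuation unit has positive witness `N`. [folklore] -/
theorem exists_pos {y : K} (h : IsVUnit y) :
    ∃ N : ℕ, 0 < N ∧ 1 ≤ (N : K) * |y| ∧ |y| ≤ N := by
  obtain ⟨N, h1, h2⟩ := h
  refine ⟨N, ?_, h1, h2⟩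
  rcases Nat.eq_zero_or_pos N with rfl | hN
  · norm_num at h1
  · exact hN

/-- The inverse of a valuation unit is a valuation unit. [folklore] -/
theorem inv {y : K} (h : IsVUnit y) : IsVUnit y⁻¹ := by
  have hy : 0 < |y| := abs_pos.2 h.ne_zero
  obtain ⟨N, hN, h1, h2⟩ := h.exists_pos
  have hNK : (0 : K) < N := by exact_mod_cast hN
  refine ⟨N, ?_, ?_⟩
  · rw [abs_inv, ← div_eq_mul_inv, le_div_iff₀ hy, one_mul]
    exact h2
  · rw [abs_inv, inv_le_iff_one_le_mul₀ hy]
    simpa [mul_comm] using h1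

/-- A product of valuation units is a valuation unit. [folklore] -/
theorem mul {y z : K} (hy : IsVUnit y) (hz : IsVUnit z) : IsVUnit (y * z) := by
  obtain ⟨N, hN, hy1, hy2⟩ := hy.exists_pos
  obtain ⟨M, hM, hz1, hz2⟩ := hz.exists_pos
  have hya : 0 < |y| := abs_pos.2 hy.ne_zero
  have hza : 0 < |z| := abs_pos.2 hz.ne_zero
  refine ⟨N * M, ?_, ?_⟩
  · rw [abs_mul]
    push_cast
    nlinarith
  · rw [abs_mul]
    push_cast
    exact mul_le_mul hy2 hz2 hza.le (by positivity)

end IsVUnit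

/-- Being a valuation unit only depends on the absolute value. [folklore] -/
@[simp] theorem isVUnit_abs {y : K} : IsVUnit |y| ↔ IsVUnit y := by
  simp [IsVUnit, abs_abs]

/-! ### Finite distance to the small model, infinite elements -/

section Core

variable (f : k ↪[Language.orderedExpRing] K) (S : Subfield K)

/-- `NearK f S x`: `x` is an element of the intermediate field `S` at **finite distance from `k`**,
i.e. `x ∈ k + Fin(S)` — den Besten's subspace `U = k + Fin(k*)` of `k*` (proof of Lemma 7.2.3). [cite: DenBesten2016, Lemma 7.2.3] -/
def NearK (x : K) : Prop := x ∈ S ∧ ∃ (b : k) (N : ℕ), |x - f b| ≤ N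

/-- `InfK f x`: `x` is **positive infinite over `k`**: it exceeds (the image of) every element of
`k` ("`|α_l| > b` for all `b ∈ k`", den Besten (35); Wilkie's `(*)ₘ`). [cite: DenBesten2016, Lemma 7.2.4] -/
def InfK (x : K) : Prop := ∀ b : k, f b < x

variable {f S}

/-- `0` is at finite distance from `k`. [folklore] -/
theorem nearK_zero : NearK f S 0 := ⟨S.zero_mem, 0, 0, by simp⟩

/-- Elements of `k` (in `S`) are at finite distance from `k`. [folklore] -/
theorem nearK_map {b : k} (hb : f b ∈ S) : NearK f S (f b) := ⟨hb, b, 0, by simp⟩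

/-- `k + Fin(S)` is closed under addition. [folklore] -/
theorem NearK.add {x y : K} (hx : NearK f S x) (hy : NearK f S y) : NearK f S (x + y) := by
  obtain ⟨hxS, b, N, hb⟩ := hx
  obtain ⟨hyS, c, M, hc⟩ := hy
  refine ⟨S.add_mem hxS hyS, b + c, N + M, ?_⟩
  rw [RealExpModel.map_add]
  calc |x + y - (f b + f c)| = |(x - f b) + (y - f c)| := by ring_nf
    _ ≤ |x - f b| + |y - f c| := abs_add_le _ _
    _ ≤ N + M := add_le_add hb hc
    _ = ((N + M : ℕ) : K) := by push_cast; ring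

/-- `k + Fin(S)` is closed under negation. [folklore] -/
theorem NearK.neg {x : K} (hx : NearK f S x) : NearK f S (-x) := by
  obtain ⟨hxS, b, N, hb⟩ := hx
  refine ⟨S.neg_mem hxS, -b, N, ?_⟩
  rw [RealExpModel.map_neg]
  calc |-x - -f b| = |x - f b| := by rw [← abs_neg]; ring_nf
    _ ≤ N := hb

/-- `k + Fin(S)` is closed under integer multiples. [folklore] -/
theorem NearK.intCast_mul {x : K} (hx : NearK f S x) (z : ℤ) : NearK f S ((z : K) * x) := by
  obtain ⟨hxS, b, N, hb⟩ := hx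
  refine ⟨S.mul_mem (S.intCast_mem z) hxS, z * b, z.natAbs * N, ?_⟩
  rw [RealExpModel.map_mul, MsStep.map_intCast']
  have hz : |(z : K)| = (z.natAbs : K) := by
    rw [← Int.cast_abs, ← Int.natCast_natAbs, Int.cast_natCast]
  calc |(z : K) * x - (z : K) * f b| = |(z : K)| * |x - f b| := by rw [← mul_sub, abs_mul]
    _ ≤ (z.natAbs : K) * N := by
        rw [hz]
        exact mul_le_mul_of_nonneg_left hb (by positivity)
    _ = ((z.natAbs * N : ℕ) : K) := by push_cast; ring

/-- `k + Fin(S)` is closed under finite sums. [folklore] -/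
theorem nearK_sum {ι : Type} (T : Finset ι) {g : ι → K} (hg : ∀ i ∈ T, NearK f S (g i)) :
    NearK f S (∑ i ∈ T, g i) :=
  Finset.sum_induction g (NearK f S) (fun _ _ hx hy => hx.add hy) nearK_zero hg

/-- An element at finite distance from `k` is bounded above by an element of `k`. [folklore] -/
theorem NearK.exists_le {x : K} (hx : NearK f S x) : ∃ b : k, x ≤ f b := by
  obtain ⟨-, b, N, hb⟩ := hx
  refine ⟨b + N, ?_⟩
  rw [RealExpModel.map_add, MsStep.map_natCast']
  linarith [(abs_le.1 hb).2]

/-- An element at finite distance from `k` is bounded in absolute value by an element of `k`. [folklore] -/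
theorem NearK.exists_abs_le {x : K} (hx : NearK f S x) : ∃ b : k, |x| ≤ f b := by
  obtain ⟨-, b, N, hb⟩ := hx
  refine ⟨|b| + N, ?_⟩
  rw [RealExpModel.map_add, MsStep.map_natCast', map_abs']
  calc |x| = |(x - f b) + f b| := by ring_nf
    _ ≤ |x - f b| + |f b| := abs_add_le _ _
    _ ≤ N + |f b| := by linarith
    _ = |f b| + N := by ring

/-- A positive infinite element exceeds every natural number. [folklore] -/
theorem InfK.natCast_lt {x : K} (hx : InfK f x) (n : ℕ) : (n : K) < x := by
  simpa using hx n

/-- A positive infinite element is positive. [folklore] -/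
theorem InfK.pos {x : K} (hx : InfK f x) : 0 < x := by
  simpa using hx.natCast_lt 0

/-- A positive infinite element exceeds `1`. [folklore] -/
theorem InfK.one_lt {x : K} (hx : InfK f x) : 1 < x := by
  simpa using hx.natCast_lt 1

/-- Anything above a positive infinite element is positive infinite. [folklore] -/
theorem InfK.mono {x y : K} (hx : InfK f x) (hxy : x ≤ y) : InfK f y := fun b =>
  lt_of_lt_of_le (hx b) hxy

/-- Half of a positive infinite element is positive infinite. [folklore] -/
theorem InfK.half {x : K} (hx : InfK f x) : InfK f (x / 2) := fun b => by
  have h := hx (2 * b)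
  rw [RealExpModel.map_mul] at h
  have h2 : f (2 : k) = (2 : K) := by exact_mod_cast MsStep.map_natCast' f 2
  rw [h2] at h
  linarith

/-- A natural submultiple of a positive infinite element is positive infinite. [folklore] -/
theorem InfK.of_le_natCast_mul {x y : K} (hx : InfK f x) {M : ℕ} (h : x ≤ (M : K) * y) :
    InfK f y := fun b => by
  rcases Nat.eq_zero_or_pos M with rfl | hM
  · simp at h
    exact absurd h (not_le.2 hx.pos)
  · have hMK : (0 : K) < M := by exact_mod_cast hM
    have h1 := hx (M * b)
    rw [RealExpModel.map_mul, MsStep.map_natCast'] at h1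
    nlinarith

/-- A positive infinite element is not at finite distance from `k`. [folklore] -/
theorem InfK.not_nearK {x : K} (hx : InfK f x) : ¬ NearK f S x := fun h => by
  obtain ⟨b, hb⟩ := h.exists_le
  exact absurd hb (not_le.2 (hx b))

/-- An element of absolute value positive infinite is not at finite distance from `k`. [folklore] -/
theorem InfK.not_nearK_of_abs {x : K} (hx : InfK f |x|) : ¬ NearK f S x := fun h => by
  obtain ⟨b, hb⟩ := h.exists_abs_le
  exact absurd hb (not_le.2 (hx b))

/-- Translating a positive infinite element by an element at finite distance from `k` keeps it
positive infinite. [folklore] -/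
theorem InfK.add_nearK {x u : K} (hx : InfK f x) (hu : NearK f S u) : InfK f (x + u) := fun b => by
  obtain ⟨c, hc⟩ := hu.neg.exists_le
  have h := hx (b + c)
  rw [RealExpModel.map_add] at h
  linarith

/-- `exp` maps elements bounded by `k` to elements bounded by `k`; contrapositively, if `exp w`
is positive infinite over `k` then so is `w`. [folklore] -/
theorem InfK.of_exp {w : K} (hw : InfK f (exp w)) : InfK f w := fun b => by
  by_contra h
  push Not at h
  have h1 : exp w ≤ exp (f b) := by
    rcases h.lt_or_eq with h | h
    · exact (exp_lt_exp h).le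
    · rw [h]
  rw [← RealExpModel.map_exp] at h1
  exact absurd h1 (not_le.2 (hw (exp b)))

end Core


/-! ### The `ℤ`-span `W = (k + Fin(S)) + Σ ℤ aᵢ` and its infinite elements -/

section Span

variable (f : k ↪[Language.orderedExpRing] K) (S : Subfield K) {m : ℕ} (a : Fin m → K)

/-- `InW f S a x`: `x = u + Σ νᵢ aᵢ` with `u ∈ k + Fin(S)` and integers `νᵢ` — membership in the
`ℤ`-span `W` of `U = k + Fin(S)` and the `aᵢ` (den Besten's space `V ⊇ U` spanned by the `αᵢ`,
`i ∈ s`, in the proof of Lemma 7.2.3, with `ℤ` for `ℚ`). [cite: DenBesten2016, Lemma 7.2.3] -/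
def InW (x : K) : Prop := ∃ u, NearK f S u ∧ ∃ ν : Fin m → ℤ, x = u + ∑ i, (ν i : K) * a i

variable {f S a}

/-- Elements of the form `u + Σ νᵢ aᵢ` are in `W`. [folklore] -/
theorem inW_of_nearK {u : K} (hu : NearK f S u) (ν : Fin m → ℤ) :
    InW f S a (u + ∑ i, (ν i : K) * a i) := ⟨u, hu, ν, rfl⟩

/-- Each `aᵢ` is in `W`. [folklore] -/
theorem inW_single (i : Fin m) : InW f S a (a i) := by
  classical
  refine ⟨0, nearK_zero, Pi.single i 1, ?_⟩
  rw [Finset.sum_eq_single i (fun j _ hj => by simp [hj]) (by simp)]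
  simp

/-- `W` is closed under negation. [folklore] -/
theorem InW.neg {x : K} (hx : InW f S a x) : InW f S a (-x) := by
  obtain ⟨u, hu, ν, rfl⟩ := hx
  refine ⟨-u, hu.neg, -ν, ?_⟩
  simp only [Pi.neg_apply, Int.cast_neg, neg_mul, Finset.sum_neg_distrib]
  ring

/-- `W` is closed under absolute values. [folklore] -/
theorem InW.abs {x : K} (hx : InW f S a x) : InW f S a |x| := by
  rcases abs_choice x with h | h <;> rw [h]
  exacts [hx, hx.neg]

/-- `W ⊆ S` (when the `aᵢ` lie in `S`). [folklore] -/
theorem InW.mem {x : K} (ha : ∀ i, a i ∈ S) (hx : InW f S a x) : x ∈ S := by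
  obtain ⟨u, hu, ν, rfl⟩ := hx
  exact S.add_mem hu.1 (S.sum_mem fun i _ => S.mul_mem (S.intCast_mem _) (ha i))

/-- **At most `m` archimedean classes of infinite elements of `W`** (the dimension count behind
den Besten's use of Lemma 7.2.2, `W/U` having rank at most `m`): a chain `x₀ ≪ x₁ ≪ ⋯ ≪ x_{t-1}`
of positive infinite elements of `W`, each exceeding all natural multiples of the previous ones,
has length `t ≤ m` — an integer relation among `m + 1` rows of coefficients (a kernel vector of
a square integer matrix with a zero row) puts `Σ λⱼ xⱼ`, which is as large as its top term, into
`k + Fin(S)`. [cite: DenBesten2016, Lemmas 7.2.2–7.2.3] -/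
theorem chain_length_le {t : ℕ} (x : Fin t → K) (hW : ∀ j, InW f S a (x j)) (hI : ∀ j, InfK f (x j))
    (hD : ∀ j l, j < l → ∀ M : ℕ, (M : K) * x j < x l) : t ≤ m := by
  classical
  by_contra ht
  push Not at ht
  -- restrict to the first `m + 1` elements
  let ι : Fin (m + 1) → Fin t := fun j => ⟨j, by omega⟩
  have hι : ∀ j l : Fin (m + 1), j < l → ι j < ι l := fun j l h => h
  choose u hu ν hν using fun j : Fin (m + 1) => hW (ι j)
  -- an integer square matrix with a zero last row: rows `i < m` are the coefficient of `aᵢ`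
  let A : Matrix (Fin (m + 1)) (Fin (m + 1)) ℤ := fun r c =>
    if h : (r : ℕ) < m then ν c ⟨r, h⟩ else 0
  have hdet : A.det = 0 :=
    Matrix.det_eq_zero_of_row_eq_zero (Fin.last m) fun c => by simp [A]
  obtain ⟨lam, hlam0, hlam⟩ := Matrix.exists_mulVec_eq_zero_iff.2 hdet
  have hrel : ∀ i : Fin m, ∑ c, ν c i * lam c = 0 := by
    intro i
    have hA : ∀ c, A (Fin.castSucc i) c = ν c i := by
      intro c
      simp only [A, Fin.val_castSucc, i.is_lt, dif_pos, Fin.eta]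
    have h := congrFun hlam (Fin.castSucc i)
    simp only [Matrix.mulVec, dotProduct, hA, Pi.zero_apply] at h
    exact h
  -- the combination `Y = Σ λ_c x_c` lies in `k + Fin(S)`
  have hY : ∑ c, (lam c : K) * x (ι c) = ∑ c, (lam c : K) * u c := by
    have h1 : ∀ c, (lam c : K) * x (ι c) =
        (lam c : K) * u c + ∑ i, ((lam c : K) * (ν c i : K)) * a i := by
      intro c
      rw [hν c, mul_add, Finset.mul_sum]
      congr 1
      exact Finset.sum_congr rfl fun i _ => by ring
    rw [Finset.sum_congr rfl fun c _ => h1 c, Finset.sum_add_distrib, Finset.sum_comm]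
    have h0 : ∀ i : Fin m, ∑ c, ((lam c : K) * (ν c i : K)) * a i = 0 := by
      intro i
      rw [← Finset.sum_mul]
      have : ∑ c, ((lam c : K) * (ν c i : K)) = ((∑ c, ν c i * lam c : ℤ) : K) := by
        push_cast
        exact Finset.sum_congr rfl fun c _ => by ring
      rw [this, hrel i]
      simp
    simp [h0]
  have hnear : NearK f S (∑ c, (lam c : K) * x (ι c)) := by
    rw [hY]
    exact nearK_sum _ fun c _ => (hu c).intCast_mul (lam c)
  -- the largest index with a nonzero coefficient
  have hne : (Finset.univ.filter fun c => lam c ≠ 0).Nonempty := by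
    by_contra h
    rw [Finset.not_nonempty_iff_eq_empty, Finset.filter_eq_empty_iff] at h
    apply hlam0
    funext c
    simpa using h (Finset.mem_univ c)
  set c₀ := (Finset.univ.filter fun c => lam c ≠ 0).max' hne with hc₀
  have hc₀ne : lam c₀ ≠ 0 := by
    have := Finset.max'_mem _ hne
    rw [Finset.mem_filter] at this
    exact this.2
  have hle : ∀ c, lam c ≠ 0 → c ≤ c₀ := fun c hc =>
    Finset.le_max' _ c (by rw [Finset.mem_filter]; exact ⟨Finset.mem_univ c, hc⟩)
  have hx0 : 0 < x (ι c₀) := (hI _).pos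
  -- the other terms are dominated: `2 (m + 1) |λ_c| x_c ≤ x_{c₀}` for `c ≠ c₀`
  have hterm : ∀ c, c ≠ c₀ → (2 * ((m : K) + 1)) * (|(lam c : K)| * x (ι c)) ≤ x (ι c₀) := by
    intro c hc
    by_cases h0 : lam c = 0
    · simp [h0, hx0.le]
    · have hlt : c < c₀ := lt_of_le_of_ne (hle c h0) hc
      have h := hD (ι c) (ι c₀) (hι c c₀ hlt) (2 * (m + 1) * (lam c).natAbs)
      have hz : |(lam c : K)| = ((lam c).natAbs : K) := by
        rw [← Int.cast_abs, ← Int.natCast_natAbs, Int.cast_natCast]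
      rw [hz]
      push_cast at h
      linarith
  set R := ∑ c ∈ Finset.univ.erase c₀, (lam c : K) * x (ι c) with hR
  have hRabs : |R| ≤ ∑ c ∈ Finset.univ.erase c₀, |(lam c : K)| * x (ι c) := by
    refine (Finset.abs_sum_le_sum_abs _ _).trans (Finset.sum_le_sum fun c _ => ?_)
    rw [abs_mul, abs_of_pos (hI _).pos]
  have hsum : (2 : K) * ∑ c ∈ Finset.univ.erase c₀, |(lam c : K)| * x (ι c) < x (ι c₀) := by
    have h1 : ∑ c ∈ Finset.univ.erase c₀, (2 * ((m : K) + 1)) * (|(lam c : K)| * x (ι c)) ≤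
        ∑ c ∈ Finset.univ.erase c₀, x (ι c₀) :=
      Finset.sum_le_sum fun c hc => hterm c (Finset.ne_of_mem_erase hc)
    rw [Finset.sum_const, Finset.card_erase_of_mem (Finset.mem_univ _), Finset.card_univ,
      Fintype.card_fin, ← Finset.mul_sum, nsmul_eq_mul] at h1
    simp only [Nat.add_sub_cancel] at h1
    have hS0 : 0 ≤ ∑ c ∈ Finset.univ.erase c₀, |(lam c : K)| * x (ι c) :=
      Finset.sum_nonneg fun c _ => mul_nonneg (abs_nonneg _) (hI _).pos.le
    have hm1 : (0 : K) < (m : K) + 1 := by positivity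
    nlinarith
  have hsplit : ∑ c, (lam c : K) * x (ι c) = (lam c₀ : K) * x (ι c₀) + R :=
    (Finset.add_sum_erase _ _ (Finset.mem_univ c₀)).symm
  have hmain : x (ι c₀) / 2 ≤ |∑ c, (lam c : K) * x (ι c)| := by
    have h1 : (1 : K) ≤ |(lam c₀ : K)| := by exact_mod_cast Int.one_le_abs hc₀ne
    rw [hsplit]
    have h2 : |(lam c₀ : K) * x (ι c₀)| ≤ |(lam c₀ : K) * x (ι c₀) + R| + |R| := by
      have := abs_add_le ((lam c₀ : K) * x (ι c₀) + R) (-R)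
      rwa [add_neg_cancel_right, abs_neg] at this
    rw [abs_mul, abs_of_pos hx0] at h2
    nlinarith
  -- contradiction: `|Y|` is positive infinite, but `Y ∈ k + Fin(S)`
  exact ((hI (ι c₀)).half.mono hmain).not_nearK_of_abs hnear

/-- **A positive infinite element of `W` of minimal archimedean class** exists as soon as some
`|a_{i₀}|` is infinite over `k`: otherwise one could descend forever, contradicting
`RealExpModel.chain_length_le`. This element replaces the adapted basis of den Besten's
Lemma 7.2.2. [cite: DenBesten2016, Lemma 7.2.2] -/
theorem exists_inW_infK_minimal {i₀ : Fin m} (hi₀ : ∀ b : k, f b < |a i₀|) :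
    ∃ v, InW f S a v ∧ InfK f v ∧
      ∀ y, InW f S a y → InfK f y → ∃ M : ℕ, v ≤ (M : K) * y := by
  classical
  by_contra hnone
  push Not at hnone
  choose g hgW hgI hgD using hnone
  -- descend from `|a_{i₀}|`
  let B := {v : K // InW f S a v ∧ InfK f v}
  let b₀ : B := ⟨|a i₀|, (inW_single i₀).abs, hi₀⟩
  let step : B → B := fun w => ⟨g w.1 w.2.1 w.2.2, hgW _ _ _, hgI _ _ _⟩
  let z : ℕ → B := fun r => step^[r] b₀
  have hstep : ∀ r (M : ℕ), (M : K) * (z (r + 1)).1 < (z r).1 := by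
    intro r M
    have hz : z (r + 1) = step (z r) := Function.iterate_succ_apply' step r b₀
    rw [hz]
    exact hgD _ _ _ M
  have hchain : ∀ r r', r < r' → ∀ M : ℕ, (M : K) * (z r').1 < (z r).1 := by
    intro r r' h
    induction h with
    | refl => exact hstep r
    | step _ ih =>
      intro M
      refine (hstep _ M).trans ?_
      simpa using ih 1
  let x : Fin (m + 1) → K := fun j => (z (m - j)).1
  have h := chain_length_le x (fun j => (z _).2.1) (fun j => (z _).2.2)
    (fun j l hjl M => hchain (m - l) (m - j) (by omega) M)
  omega

end Span


/-! ### Lemma 9.3 for one configuration, from the valuation-rank bound -/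

section Main

variable {f : k ↪[Language.orderedExpRing] K} {S : Subfield K} {m : ℕ} {a : Fin m → K}

/-- `f` on the inverse of `2`. [folklore] -/
theorem map_inv_two : f ((2 : k)⁻¹) = (2 : K)⁻¹ := by
  rw [← coe_toRingHom, map_inv₀, map_ofNat]

/-- **The heart of den Besten's Lemma 7.2.3 / Wilkie's §11** (contradiction form). Let `S ⊆ K`
be an intermediate field containing `k`, the `aᵢ` and the `exp aᵢ` (`i < m`), of valuation rank
at most `m` over `k` (`hrank`: any `m + 1` nonzero elements of `S` have a nontrivial power
product which is a valuation unit up to a factor from `k`), and suppose some `|a_{i₀}|` is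
infinite over `k`. Then the `aᵢ` cannot be `ℤ`-independent modulo `k + Fin(S)`. Proof: take a
positive infinite `v ∈ W` of minimal archimedean class (`RealExpModel.exists_inW_infK_minimal`)
and apply `hrank` to `(v, exp a₀, …, exp a_{m-1})`: a relation not involving `v` would put
`Σ eᵢ aᵢ` at finite distance from `k` (as `exp⁻¹` of a unit times an element of `k` is finite:
"`1 + x ≤ exp(x)` … implies `d + Σ qᵢvᵢ ∈ Fin`", proof of the Claim in Lemma 7.2.3), contradicting independence;
a relation `v^p ≍ exp(w)` with `p ≥ 1`, `w ∈ W` forces `w` infinite over `k`, hence `v ≤ M w`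
by minimality, and then `exp(w) ≤ N v^p ≤ N M^p w^p` contradicts the growth of `exp` ("by simply
reasoning in `ℝ`, … `exp(qx) ≥ Nx` for all `x > r`", end of the proof of Lemma 7.2.3). [cite: DenBesten2016, Lemma 7.2.3] -/
theorem not_independent_of_valRank
    (hk : ∀ b : k, f b ∈ S) (ha : ∀ i, a i ∈ S) (hea : ∀ i, exp (a i) ∈ S)
    (hrank : ∀ x : Fin (m + 1) → K, (∀ j, x j ∈ S) → (∀ j, x j ≠ 0) →
      ∃ e : Fin (m + 1) → ℤ, e ≠ 0 ∧ ∃ c : k, c ≠ 0 ∧ IsVUnit (f c * ∏ j, x j ^ e j))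
    {i₀ : Fin m} (hi₀ : ∀ b : k, f b < |a i₀|) :
    ¬ ∀ ν : Fin m → ℤ, NearK f S (∑ i, (ν i : K) * a i) → ν = 0 := by
  classical
  intro hind
  obtain ⟨v, hvW, hvI, hvmin⟩ := exists_inW_infK_minimal (f := f) (S := S) (a := a) hi₀
  have hv0 : 0 < v := hvI.pos
  -- apply the rank bound to `(v, exp a₀, …, exp a_{m-1})`
  let x : Fin (m + 1) → K := Fin.cons v fun i => exp (a i)
  have hx0v : x 0 = v := rfl
  have hxs : ∀ i : Fin m, x i.succ = exp (a i) := fun i => rfl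
  have hxS : ∀ j, x j ∈ S := by
    refine Fin.cases ?_ (fun i => ?_)
    · rw [hx0v]; exact hvW.mem ha
    · rw [hxs]; exact hea i
  have hxne : ∀ j, x j ≠ 0 := by
    refine Fin.cases ?_ (fun i => ?_)
    · rw [hx0v]; exact hv0.ne'
    · rw [hxs]; exact exp_ne_zero (a i)
  obtain ⟨e, he0, c, hc0, hunit⟩ := hrank x hxS hxne
  set σ : K := ∑ i, ((e i.succ : ℤ) : K) * a i with hσ
  have hσS : σ ∈ S := S.sum_mem fun i _ => S.mul_mem (S.intCast_mem _) (ha i)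
  have hprod : ∏ j, x j ^ e j = v ^ e 0 * exp σ := by
    rw [Fin.prod_univ_succ, hσ, exp_sum_intCast_mul_eq_prod_zpow]
    rfl
  -- `|f c| = exp (f d)` for some `d ∈ k`
  obtain ⟨d, hd⟩ := exists_exp_eq (abs_pos.2 hc0)
  have hfc : |f c| = exp (f d) := by rw [← map_abs', ← hd, RealExpModel.map_exp]
  -- the unit in absolute value
  have hunit' : IsVUnit (v ^ e 0 * exp (f d + σ)) := by
    have habs : |f c * ∏ j, x j ^ e j| = v ^ e 0 * exp (f d + σ) := by
      rw [hprod, abs_mul, hfc, abs_mul, abs_of_pos (zpow_pos hv0 _), abs_of_pos (exp_pos _),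
        exp_add]
      ring
    rw [← isVUnit_abs, habs] at hunit
    exact hunit
  by_cases he00 : e 0 = 0
  · -- a relation among the `exp aᵢ` alone: `Σ eᵢ aᵢ ∈ k + Fin(S)`, contradicting independence
    rw [he00, zpow_zero, one_mul] at hunit'
    obtain ⟨N, h1, h2⟩ := hunit'
    rw [abs_of_pos (exp_pos _)] at h1 h2
    have hlt := lt_of_exp_le h2
    have hgt := neg_lt_of_one_le_mul_exp h1
    have hnear : NearK f S σ := by
      refine ⟨hσS, -d, N, ?_⟩
      rw [RealExpModel.map_neg, sub_neg_eq_add, add_comm, abs_le]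
      exact ⟨hgt.le, hlt.le⟩
    have hzero := hind (fun i => e i.succ) hnear
    apply he0
    funext j
    refine Fin.cases he00 (fun i => ?_) j
    exact congrFun hzero i
  · -- a relation `v ^ p ≍ exp w` with `p ≥ 1` and `w ∈ W`
    set p : ℕ := (e 0).natAbs with hp
    have hp0 : 0 < p := Int.natAbs_pos.2 he00
    have hkey : ∃ w, InW f S a w ∧ IsVUnit (v ^ p * exp (-w)) := by
      have hW : InW f S a (f d + σ) := inW_of_nearK (nearK_map (hk d)) fun i => e i.succ
      rcases lt_or_gt_of_ne he00 with hneg | hpos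
      · -- `e 0 = -p`
        have he : e 0 = -(p : ℤ) := by rw [hp]; omega
        refine ⟨f d + σ, hW, ?_⟩
        have h := hunit'.inv
        rw [he, mul_inv, zpow_neg, inv_inv, zpow_natCast, ← exp_neg'] at h
        exact h
      · -- `e 0 = p`
        have he : e 0 = (p : ℤ) := by rw [hp]; omega
        refine ⟨-(f d + σ), hW.neg, ?_⟩
        rw [he, zpow_natCast] at hunit'
        rw [neg_neg]
        exact hunit'
    obtain ⟨w, hwW, hwunit⟩ := hkey
    obtain ⟨N, hN, h1, h2⟩ := hwunit.exists_pos
    have hvp : 0 < v ^ p := pow_pos hv0 p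
    rw [abs_of_pos (mul_pos hvp (exp_pos _))] at h1 h2
    have hexpw : 0 < exp w := exp_pos w
    -- `exp w ≤ N v^p` and `v^p ≤ N exp w`
    have hup : exp w ≤ (N : K) * v ^ p := by
      have : (1 : K) * exp w ≤ (N : K) * (v ^ p * exp (-w)) * exp w :=
        mul_le_mul_of_nonneg_right h1 hexpw.le
      rwa [one_mul, mul_assoc, mul_assoc, ← exp_add, neg_add_cancel, exp_zero, mul_one] at this
    have hdown : v ^ p ≤ (N : K) * exp w := by
      have : v ^ p * exp (-w) * exp w ≤ (N : K) * exp w := mul_le_mul_of_nonneg_right h2 hexpw.le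
      rwa [mul_assoc, ← exp_add, neg_add_cancel, exp_zero, mul_one] at this
    -- `w` is infinite over `k`
    have hv1 : 1 ≤ v := hvI.one_lt.le
    have hvle : v ≤ v ^ p := le_self_pow₀ hv1 hp0.ne'
    have hwI : InfK f w := (hvI.of_le_natCast_mul (hvle.trans hdown)).of_exp
    -- minimality of `v`
    obtain ⟨M, hM⟩ := hvmin w hwW hwI
    have hw0 : 0 < w := hwI.pos
    have hvpow : v ^ p ≤ ((M : K) * w) ^ p := pow_le_pow_left₀ hv0.le hM p
    have hgrowth := natCast_mul_pow_lt_exp hwI.natCast_lt (N * M ^ p) p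
    push_cast at hgrowth
    have : exp w ≤ (N : K) * (M : K) ^ p * w ^ p := by
      calc exp w ≤ (N : K) * v ^ p := hup
        _ ≤ (N : K) * ((M : K) * w) ^ p := mul_le_mul_of_nonneg_left hvpow (by positivity)
        _ = (N : K) * (M : K) ^ p * w ^ p := by rw [mul_pow]; ring
    linarith

/-- **Lemma 9.3 for one configuration, from the valuation-rank bound** (den Besten, Lemma 7.2.3,
end of the proof of Lemma 7.2.4, and the derivation of (36) closing §7.2; Wilkie 1996, §11). Let
`S ⊆ K` be an intermediate field containing `k`, the `aᵢ` and `exp aᵢ` (`i < m`), whose valuation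
rank over `k` is at most `m` — in the source `S = k* = Dcl_{k'}(ᾱ, exp ᾱ_s)`, where this is
`valdim_{k'}(k*) ≤ dim_{k'}(k*) ≤ m` (Theorems 7.1.23, 7.2.1, the Claim in 7.2.4). If some
`|a_{i₀}|` exceeds every element of `k`, then `0 < c + Σ νᵢ aᵢ < 1` for some integers `νᵢ`, not
all zero, and some `c ∈ k`: by `RealExpModel.not_independent_of_valRank` there is a nontrivial
`Σ νᵢ aᵢ = a + b` with `a ∈ k`, `b` finite, "there exists `q ∈ ℚ` such that `0 < q - b < 1`. We
can then take `c = q + a`" (here via an integer part of `b`). [cite: DenBesten2016, Lemmas 7.2.3–7.2.4 and (36)] -/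
theorem exists_intCombination_mem_Ioo_of_valRank
    (hk : ∀ b : k, f b ∈ S) (ha : ∀ i, a i ∈ S) (hea : ∀ i, exp (a i) ∈ S)
    (hrank : ∀ x : Fin (m + 1) → K, (∀ j, x j ∈ S) → (∀ j, x j ≠ 0) →
      ∃ e : Fin (m + 1) → ℤ, e ≠ 0 ∧ ∃ c : k, c ≠ 0 ∧ IsVUnit (f c * ∏ j, x j ^ e j))
    {i₀ : Fin m} (hi₀ : ∀ b : k, f b < |a i₀|) :
    ∃ (ν : Fin m → ℤ) (c : k), ν ≠ 0 ∧
      0 < f c + ∑ i, (ν i : K) * a i ∧ f c + ∑ i, (ν i : K) * a i < 1 := by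
  classical
  have h := not_independent_of_valRank hk ha hea hrank hi₀
  push Not at h
  obtain ⟨ν, ⟨-, b, N, hbN⟩, hν⟩ := h
  obtain ⟨z, hz1, hz2⟩ := exists_int_floor_of_abs_le hbN
  by_cases ht : ∑ i, (ν i : K) * a i - f b - z < 2⁻¹
  · refine ⟨ν, -b - z + 2⁻¹, hν, ?_, ?_⟩
    · rw [RealExpModel.map_add, map_sub'', RealExpModel.map_neg, MsStep.map_intCast', map_inv_two]
      linarith
    · rw [RealExpModel.map_add, map_sub'', RealExpModel.map_neg, MsStep.map_intCast', map_inv_two]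
      linarith
  · push Not at ht
    refine ⟨ν, -b - z, hν, ?_, ?_⟩
    · rw [map_sub'', RealExpModel.map_neg, MsStep.map_intCast']
      have : (0 : K) < 2⁻¹ := by norm_num
      linarith
    · rw [map_sub'', RealExpModel.map_neg, MsStep.map_intCast']
      linarith

end Main

end RealExpModel

/-! ### Lemma 9.3, the printed leaf and Wilkie's theorem from the valuation-rank bound -/

open RealExpModel in
/-- **Wilkie 1996, 9.3 (den Besten's condition (36) / Lemma 7.2.4) from the valuation-rank
bound.** For a pair of models `f : k ↪ K` of `T_exp`: if for every non-singular zero `ᾱ` of a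
square system from `Mˢₙ` over `k` there is an intermediate field `k ⊆ S ⊆ K` containing the
`αᵢ` and `exp αᵢ` (`i ∈ s`) whose valuation rank over `k` is at most `|s|` (hypothesis `hVR` —
in the source `S = Dcl_{k'}(ᾱ, exp ᾱ_s)`, of `T_e`-dimension `≤ |s|` over `k' ≼ K'` by the
non-singularity of the system and Khovanskiĭ finiteness (the Claim in Lemma 7.2.4), hence of
valuation rank `≤ |s|` by the valuation inequality for the smooth theory `T_e`, Theorems 7.1.23
and 7.2.1, which rest on the First Main Theorem), then whenever `l ∈ s` and `|α_l| > b` for all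
`b ∈ k`, there are integers `nᵢ` (`i ∈ s`), not all zero, and `c ∈ k` with
`0 < c + Σ_{i ∈ s} nᵢ αᵢ < 1`. This is exactly the hypothesis `h93` of
`RealExpModel.exists_abs_lt_of_isMsZero_of_lemma93` (`Wilkie1996Induction.lean`). [cite: DenBesten2016, Lemma 7.2.4 and (36)] -/
theorem RealExpModel.lemma93_of_valRank
    {k K : Language.Theory.ModelType.{0, 0, 0} realExpTheory} (f : k ↪[Language.orderedExpRing] K)
    (hVR : ∀ (n : ℕ) (s : Finset (Fin n)) (P : Fin n → MvPolynomial (MsVar n) k) (α : Fin n → K),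
      IsMsZero f s P α → ∃ S : Subfield K, (∀ b : k, f b ∈ S) ∧ (∀ i ∈ s, α i ∈ S) ∧
        (∀ i ∈ s, exp (α i) ∈ S) ∧
        ∀ x : Fin (s.card + 1) → K, (∀ j, x j ∈ S) → (∀ j, x j ≠ 0) →
          ∃ e : Fin (s.card + 1) → ℤ, e ≠ 0 ∧ ∃ c : k, c ≠ 0 ∧ IsVUnit (f c * ∏ j, x j ^ e j))
    {n : ℕ} {s : Finset (Fin n)} {P : Fin n → MvPolynomial (MsVar n) k} {α : Fin n → K}
    (h : IsMsZero f s P α) {l : Fin n} (hl : l ∈ s) (hlt : ∀ b : k, f b < |α l|) :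
    ∃ (ν : Fin n → ℤ) (c : k), (∀ i, i ∉ s → ν i = 0) ∧ (∃ i, ν i ≠ 0) ∧
      0 < f c + ∑ i, (ν i : K) * α i ∧ f c + ∑ i, (ν i : K) * α i < 1 := by
  classical
  obtain ⟨S, hk, hαS, heS, hrank⟩ := hVR n s P α h
  let enum : Fin s.card ≃ s := s.equivFin.symm
  let a : Fin s.card → K := fun i => α (enum i)
  have ha : ∀ i, a i ∈ S := fun i => hαS _ (enum i).2
  have hea : ∀ i, exp (a i) ∈ S := fun i => heS _ (enum i).2
  have hi₀ : ∀ b : k, f b < |a (enum.symm ⟨l, hl⟩)| := by simpa [a] using hlt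
  obtain ⟨ν', c, hν', h0, h1⟩ := exists_intCombination_mem_Ioo_of_valRank hk ha hea hrank hi₀
  let ν : Fin n → ℤ := fun j => if hj : j ∈ s then ν' (enum.symm ⟨j, hj⟩) else 0
  have hν_enum : ∀ i, ν (enum i) = ν' i := fun i => by
    simp only [ν, (enum i).2, dif_pos, Subtype.coe_eta, Equiv.symm_apply_apply]
  have hsum : ∑ j, (ν j : K) * α j = ∑ i, (ν' i : K) * a i := by
    rw [← Finset.sum_subset (Finset.subset_univ s) fun j _ hj => by simp [ν, hj],
      ← Finset.sum_coe_sort, ← enum.sum_comp]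
    exact Finset.sum_congr rfl fun i _ => by rw [hν_enum]
  refine ⟨ν, c, fun j hj => by simp [ν, hj], ?_, by rwa [hsum], by rwa [hsum]⟩
  obtain ⟨i, hi⟩ := Function.ne_iff.1 hν'
  exact ⟨enum i, by rwa [hν_enum]⟩

open RealExpModel in
/-- **The printed leaf from the valuation-rank bound**: the boundedness of non-singular zeros of
exponential-polynomial systems over submodels (`Wilkie1996_expPolynomialPoints_bounded`, Wilkie
1996, §9, p. 1083) follows from the valuation-rank bound `hVR` for all pairs of models (through
`RealExpModel.lemma93_of_valRank` and the induction of §9,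
`Wilkie1996_expPolynomialPoints_bounded_of_lemma93`). What remains outside this implication is
exactly the model theory of `T_e = Th(ℝ; exp((1+x²)⁻¹))`: its model completeness (First Main
Theorem), o-minimality and polynomial bounds (via `ℝ_an`), the valuation inequality
(den Besten, Theorem 7.1.23; Wilkie 1996, §10) and the dimension count of Lemma 7.2.4. [cite: WilkieJAMS1996, §§9–11] -/
theorem Wilkie1996_expPolynomialPoints_bounded_of_valRank
    (hVR : ∀ (k K : Language.Theory.ModelType.{0, 0, 0} realExpTheory)
      (f : k ↪[Language.orderedExpRing] K)
      (n : ℕ) (s : Finset (Fin n)) (P : Fin n → MvPolynomial (MsVar n) k) (α : Fin n → K),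
      IsMsZero f s P α → ∃ S : Subfield K, (∀ b : k, f b ∈ S) ∧ (∀ i ∈ s, α i ∈ S) ∧
        (∀ i ∈ s, exp (α i) ∈ S) ∧
        ∀ x : Fin (s.card + 1) → K, (∀ j, x j ∈ S) → (∀ j, x j ≠ 0) →
          ∃ e : Fin (s.card + 1) → ℤ, e ≠ 0 ∧ ∃ c : k, c ≠ 0 ∧ IsVUnit (f c * ∏ j, x j ^ e j)) :
    Wilkie1996_expPolynomialPoints_bounded :=
  Wilkie1996_expPolynomialPoints_bounded_of_lemma93 fun k K f _ _ _ _ h _ hl hlt =>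
    lemma93_of_valRank f (hVR k K f) h hl hlt

open RealExpModel in
/-- **Wilkie's core transfer statement from the valuation-rank bound**: the named fact
`Wilkie1996_expPolynomial_transfer` (Wilkie 1999, p. 414: solutions of `p(x̄, e^{x̄}) = 0` in `K`
descend to the submodel `k`) follows from `hVR`, through the leaf and
`Wilkie1996_expPolynomial_transfer_of_expPolynomialPoints_bounded`. [cite: WilkieJAMS1996, Second Main Theorem and §§9–11] -/
theorem Wilkie1996_expPolynomial_transfer_of_valRank
    (hVR : ∀ (k K : Language.Theory.ModelType.{0, 0, 0} realExpTheory)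
      (f : k ↪[Language.orderedExpRing] K)
      (n : ℕ) (s : Finset (Fin n)) (P : Fin n → MvPolynomial (MsVar n) k) (α : Fin n → K),
      IsMsZero f s P α → ∃ S : Subfield K, (∀ b : k, f b ∈ S) ∧ (∀ i ∈ s, α i ∈ S) ∧
        (∀ i ∈ s, exp (α i) ∈ S) ∧
        ∀ x : Fin (s.card + 1) → K, (∀ j, x j ∈ S) → (∀ j, x j ≠ 0) →
          ∃ e : Fin (s.card + 1) → ℤ, e ≠ 0 ∧ ∃ c : k, c ≠ 0 ∧ IsVUnit (f c * ∏ j, x j ^ e j)) :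
    Wilkie1996_expPolynomial_transfer :=
  Wilkie1996_expPolynomial_transfer_of_expPolynomialPoints_bounded
    (Wilkie1996_expPolynomialPoints_bounded_of_valRank hVR)

open RealExpModel in
/-- **Wilkie's theorem from the valuation-rank bound**: the model completeness of `T_exp`
(`wilkie_isModelComplete`) follows from `hVR`. [cite: WilkieJAMS1996, Second Main Theorem and §§9–11] -/
theorem wilkie_isModelComplete_of_valRank
    (hVR : ∀ (k K : Language.Theory.ModelType.{0, 0, 0} realExpTheory)
      (f : k ↪[Language.orderedExpRing] K)
      (n : ℕ) (s : Finset (Fin n)) (P : Fin n → MvPolynomial (MsVar n) k) (α : Fin n → K),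
      IsMsZero f s P α → ∃ S : Subfield K, (∀ b : k, f b ∈ S) ∧ (∀ i ∈ s, α i ∈ S) ∧
        (∀ i ∈ s, exp (α i) ∈ S) ∧
        ∀ x : Fin (s.card + 1) → K, (∀ j, x j ∈ S) → (∀ j, x j ≠ 0) →
          ∃ e : Fin (s.card + 1) → ℤ, e ≠ 0 ∧ ∃ c : k, c ≠ 0 ∧ IsVUnit (f c * ∏ j, x j ^ e j)) :
    wilkie_isModelComplete :=
  wilkie_isModelComplete_of_expPolynomialPoints_bounded
    (Wilkie1996_expPolynomialPoints_bounded_of_valRank hVR)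

open RealExpModel in
/-- **O-minimality of `ℝ_exp` from the valuation-rank bound** (`wilkie_isOMinimal`, through
`wilkie_isOMinimal_of_expPolynomialPoints_bounded` of `RealExpOMinimalProofs.lean`). [cite: WilkieJAMS1996, Second Main Theorem and §§9–11] -/
theorem wilkie_isOMinimal_of_valRank
    (hVR : ∀ (k K : Language.Theory.ModelType.{0, 0, 0} realExpTheory)
      (f : k ↪[Language.orderedExpRing] K)
      (n : ℕ) (s : Finset (Fin n)) (P : Fin n → MvPolynomial (MsVar n) k) (α : Fin n → K),
      IsMsZero f s P α → ∃ S : Subfield K, (∀ b : k, f b ∈ S) ∧ (∀ i ∈ s, α i ∈ S) ∧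
        (∀ i ∈ s, exp (α i) ∈ S) ∧
        ∀ x : Fin (s.card + 1) → K, (∀ j, x j ∈ S) → (∀ j, x j ≠ 0) →
          ∃ e : Fin (s.card + 1) → ℤ, e ≠ 0 ∧ ∃ c : k, c ≠ 0 ∧ IsVUnit (f c * ∏ j, x j ^ e j)) :
    wilkie_isOMinimal :=
  wilkie_isOMinimal_of_expPolynomialPoints_bounded
    (Wilkie1996_expPolynomialPoints_bounded_of_valRank hVR)

end Literature.ModelTheory.ExponentialFields
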